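import Mathlib
import Literature.MathematicalPhysics.QuantumFieldTheory.QCDOS
import Literature.MathematicalPhysics.QuantumFieldTheory.LatticeGaugeProofs
import Literature.MathematicalPhysics.QuantumLattice.GrassmannIntegralBerezinProofs

/-!
# Lattice QCD with NO quark flavours at `β = 0`: the torus functional is the product Haar
# measure, and it has every uniform lattice mass gap

Route `AnomalyRigidity` (QCD sub-problem), support item ⟨stmt-QuantumFields-16260⟩
`UniformGapTreeDecay` — the route-independent half of its REFUTATION.  The tree's negative lemma
`Summit.QuantumFields.QCD.Theorems.UniformGapTreeDecay.Negative.uniformGapTreeDecay_false_of_gapped`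
refutes the item modulo `GappedUnitRegularisation N_f` (a regularisation with a uniform lattice
mass gap on the mass window, bare masses on the physical branch and `⟨1⟩ = 1`); this file builds
the ingredients of the classical inhabitant at `N_f = 0`, `β_k ≡ 0` over the tree's honest torus
functional `qcdTorusExpect` (which no file had done — four refuter reads call it "sound on paper
but not small in Lean"):

* empty-index Grassmann algebras (`IsEmpty ι`): every element is the scalar `berezin a`
  (`eq_algebraMap_berezin`), the Berezin integral is multiplicative and invariant under algebra
  maps between two such algebras (`berezin_mul`, `berezin_algHom`);
* `N_f = 0`: the quark index types `FermiIdx 0 S`, `BoxFermiIdx 0 R ⊕ₗ BoxFermiIdx 0 R` are empty, the fermionic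
  Boltzmann factor is `1`, and `qcdTorusExpect β S m X = ∫ fermiIntegral (X U) dμ_{W,β}`
  (`qcdTorusExpect_zero_flavour`), in particular `⟨1⟩ = 1` (`qcdTorusExpect_one_zero_flavour`);
  a boxed observable placed on the torus integrates to the Berezin integral of its box value
  (`fermiIntegral_onTorus_zero_flavour`), hence is bounded, measurable and a cylinder function of
  the torus links it reads (`dependsOn_fermiIntegral_onTorus`);
* `β = 0`: `wilsonMeasure ρ 0` is the product Haar measure (`wilsonMeasure_beta_zero`), under
  which bounded measurable functions of disjoint link sets are independent
  (`integral_mul_eq_of_dependsOn_disjoint_pi`, Mathlib `iIndepFun_pi`);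
* the sequel `AnomalyRigidityUniformGapTreeDecayZeroFlavourGap.lean` concludes: every scheme with
  `N_f = 0` and `β_k ≡ 0` has the uniform lattice mass gap `QCDScheme.HasLatticeMassGap Δ` for
  EVERY `Δ`.

Def-free; Mathlib + tree only; no Theses import (route independent).  HONEST LABEL: ledger hygiene
on a superseded, held support item; no crux, rung or summit is touched; neither QCD nor the
Yang–Mills mass gap is proved by this.  Seat `ym-line-fcl-p3` g20 (free hands).
-/

noncomputable section

open MeasureTheory Filter Topology ProbabilityTheory
open Literature.MathematicalPhysics.QuantumFieldTheory Literature.MathematicalPhysics.QuantumLattice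

namespace Summit.QuantumFields.QCD.Theorems.UniformGapTreeDecay.EmptyFlavour

/-! ### Empty-index Grassmann algebras are the scalars -/

section EmptyIndex

variable {R : Type*} [CommRing R] {ι : Type*} [LinearOrder ι] [Fintype ι] [IsEmpty ι]

/-- On an empty index type the Berezin integral of a scalar `c·1` is `c` (the top monomial is the
empty one, `θ_∅ = 1`). -/
theorem berezin_algebraMap (c : R) :
    GrassmannAlgebra.berezin R ι (algebraMap R (GrassmannAlgebra R ι) c) = c := by
  have hu : (Finset.univ : Finset ι) = ∅ := Finset.univ_eq_empty
  rw [Algebra.algebraMap_eq_smul_one, map_smul, ← GrassmannAlgebra.grassmannBasis_empty (R := R)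
    (ι := ι), ← hu, GrassmannAlgebra.berezin_grassmannBasis_univ, smul_eq_mul, mul_one]

/-- On an empty index type every element of the Grassmann algebra is the scalar given by its
Berezin integral: `a = (∫ a)·1`. -/
theorem eq_algebraMap_berezin (a : GrassmannAlgebra R ι) :
    a = algebraMap R (GrassmannAlgebra R ι) (GrassmannAlgebra.berezin R ι a) := by
  classical
  have hs : ∀ s : Finset ι, s = ∅ := fun s => Finset.eq_empty_of_isEmpty s
  haveI : Subsingleton (Finset ι) := ⟨fun s t => by rw [hs s, hs t]⟩
  have h := (GrassmannAlgebra.grassmannBasis R ι).sum_repr a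
  rw [Fintype.sum_subsingleton _ (∅ : Finset ι), GrassmannAlgebra.grassmannBasis_empty,
    ← Algebra.algebraMap_eq_smul_one] at h
  have hb : GrassmannAlgebra.berezin R ι a = (GrassmannAlgebra.grassmannBasis R ι).repr a ∅ := by
    change ((GrassmannAlgebra.grassmannBasis R ι).coord Finset.univ) a = _
    rw [Module.Basis.coord_apply, hs Finset.univ]
  rw [hb]
  exact h.symm

/-- On an empty index type the Berezin integral is multiplicative. -/
theorem berezin_mul (a b : GrassmannAlgebra R ι) :
    GrassmannAlgebra.berezin R ι (a * b) =
      GrassmannAlgebra.berezin R ι a * GrassmannAlgebra.berezin R ι b := by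
  conv_lhs => rw [eq_algebraMap_berezin a, eq_algebraMap_berezin b, ← map_mul, berezin_algebraMap]

/-- On an empty index type the Berezin integral of `1` is `1`. -/
theorem berezin_one : GrassmannAlgebra.berezin R ι (1 : GrassmannAlgebra R ι) = 1 := by
  rw [← map_one (algebraMap R (GrassmannAlgebra R ι)), berezin_algebraMap]

/-- Between two empty-index Grassmann algebras every algebra map preserves the Berezin integral
(both are the scalars). -/
theorem berezin_algHom {ι' : Type*} [LinearOrder ι'] [Fintype ι'] [IsEmpty ι']
    (f : GrassmannAlgebra R ι →ₐ[R] GrassmannAlgebra R ι') (a : GrassmannAlgebra R ι) :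
    GrassmannAlgebra.berezin R ι' (f a) = GrassmannAlgebra.berezin R ι a := by
  conv_lhs => rw [eq_algebraMap_berezin a, AlgHom.commutes, berezin_algebraMap]

end EmptyIndex

/-! ### `N_f = 0`: no quark variables -/

section ZeroFlavour

/-- With no flavours there are no quark variables on the torus. -/
theorem isEmpty_fermiIdx_zero (S : ℕ) [NeZero S] : IsEmpty (FermiIdx 0 S) := by
  haveI : IsEmpty (QuarkVar 0 S) := by unfold QuarkVar; infer_instance
  have hc : Fintype.card (QuarkVar 0 S) = 0 := Fintype.card_eq_zero
  exact ⟨fun i => Nat.not_lt_zero _ (lt_of_lt_of_eq i.isLt hc)⟩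

/-- With no flavours the torus Grassmann index type `ψ̄ ⊕ ψ` is empty. -/
theorem isEmpty_fermiIdx_sum_zero (S : ℕ) [NeZero S] : IsEmpty (FermiIdx 0 S ⊕ₗ FermiIdx 0 S) := by
  haveI := isEmpty_fermiIdx_zero S
  exact ⟨fun x => isEmptyElim (ofLex x)⟩

/-- With no flavours the boxed Grassmann index type `ψ̄ ⊕ ψ` is empty (there are no boxed quark
variables; cf. `ThinQCD.Negative.isEmpty_boxFermiIdx_zero`, which lives in a route-dependent module
and is therefore re-derived inline here). -/
theorem isEmpty_boxFermiIdx_sum_zero (R : ℕ) : IsEmpty (BoxFermiIdx 0 R ⊕ₗ BoxFermiIdx 0 R) := by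
  haveI : IsEmpty (BoxQuarkVar 0 R) := by unfold BoxQuarkVar; infer_instance
  have hc : Fintype.card (BoxQuarkVar 0 R) = 0 := Fintype.card_eq_zero
  haveI : IsEmpty (BoxFermiIdx 0 R) := ⟨fun i => Nat.not_lt_zero _ (lt_of_lt_of_eq i.isLt hc)⟩
  exact ⟨fun x => isEmptyElim (ofLex x)⟩

/-- With no flavours the fermionic Boltzmann factor `exp(−ψ̄Dψ)` is `1` (the bilinear is an empty
sum). -/
theorem fermiBoltzmann_zero_flavour (S : ℕ) [NeZero S] (U : GaugeConfig 4 S (Matrix.specialUnitaryGroup (Fin 3) ℂ)) (mq : Fin 0 → ℝ) :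
    fermiBoltzmann U mq = 1 := by
  haveI := isEmpty_fermiIdx_zero S
  unfold fermiBoltzmann quadratic grassmannExp
  simp

/-- With no flavours the Berezin integral over the (absent) quark variables of `1` is `1`. -/
theorem fermiIntegral_one_zero_flavour (S : ℕ) [NeZero S] :
    fermiIntegral (1 : FermiAlg 0 S) = 1 := by
  haveI := isEmpty_fermiIdx_sum_zero S
  exact berezin_one

/-- **The honest torus functional with no flavours is the Wilson expectation of the Berezin
scalar**: `qcdTorusExpect β S m X = ∫ fermiIntegral (X U) dμ_{W,β}(U)` (the fermionic partition
function is `∫ 1 dμ_W = 1`). -/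
theorem qcdTorusExpect_zero_flavour (β : ℝ) (S : ℕ) [NeZero S] (mq : Fin 0 → ℝ)
    (X : GaugeConfig 4 S (Matrix.specialUnitaryGroup (Fin 3) ℂ) → FermiAlg 0 S) :
    qcdTorusExpect β S mq X =
      ∫ U, fermiIntegral (X U) ∂(wilsonMeasure (d := 4) (L := S) (fundamentalRep (Fin 3)) β) := by
  haveI : IsProbabilityMeasure (wilsonMeasure (d := 4) (L := S) (fundamentalRep (Fin 3)) β) :=
    isProbabilityMeasure_wilsonMeasure _ (continuous_fundamentalRep _) β
  unfold qcdTorusExpect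
  simp only [fermiBoltzmann_zero_flavour, mul_one, fermiIntegral_one_zero_flavour, integral_const,
    probReal_univ, one_smul, div_one]

/-- With no flavours the torus functional is normalised: `⟨1⟩ = 1`. -/
theorem qcdTorusExpect_one_zero_flavour (β : ℝ) (S : ℕ) [NeZero S] (mq : Fin 0 → ℝ) :
    qcdTorusExpect β S mq (fun _ => (1 : FermiAlg 0 S)) = 1 := by
  haveI : IsProbabilityMeasure (wilsonMeasure (d := 4) (L := S) (fundamentalRep (Fin 3)) β) :=
    isProbabilityMeasure_wilsonMeasure _ (continuous_fundamentalRep _) β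
  rw [qcdTorusExpect_zero_flavour]
  simp only [fermiIntegral_one_zero_flavour, integral_const, probReal_univ, one_smul]

/-- **A boxed observable on the torus integrates to the Berezin integral of its box value** (no
flavours: both Grassmann algebras are the scalars and `onTorus` is an algebra map). -/
theorem fermiIntegral_onTorus_zero_flavour {R : ℕ} (A : QCDLatticeObservable 0 R) (S : ℕ) [NeZero S]
    (v : Literature.Probability.LatticeModels.Site 4) (U : GaugeConfig 4 S (Matrix.specialUnitaryGroup (Fin 3) ℂ)) :
    fermiIntegral (A.onTorus S v U) =
      GrassmannAlgebra.berezin ℂ (BoxFermiIdx 0 R ⊕ₗ BoxFermiIdx 0 R)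
        (A.F (Literature.MathematicalPhysics.QuantumLattice.configShift (-v) (torusLift S U))) := by
  haveI := isEmpty_fermiIdx_sum_zero S
  haveI := isEmpty_boxFermiIdx_sum_zero R
  unfold QCDLatticeObservable.onTorus fermiIntegral
  exact berezin_algHom _ _

/-- A boxed observable with no flavours has a uniformly bounded Berezin scalar on every torus
placement. -/
theorem exists_bound_fermiIntegral_onTorus {R : ℕ} (A : QCDLatticeObservable 0 R) :
    ∃ C : ℝ, 0 ≤ C ∧ ∀ (S : ℕ) [NeZero S] (v : Literature.Probability.LatticeModels.Site 4) (U : GaugeConfig 4 S (Matrix.specialUnitaryGroup (Fin 3) ℂ)),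
      ‖fermiIntegral (A.onTorus S v U)‖ ≤ C := by
  obtain ⟨C, hC⟩ := A.bounded 1
  refine ⟨max C 0, le_max_right _ _, fun S _ v U => ?_⟩
  rw [fermiIntegral_onTorus_zero_flavour]
  have h := hC (Literature.MathematicalPhysics.QuantumLattice.configShift (-v) (torusLift S U))
  rw [mul_one] at h
  exact h.trans (le_max_left _ _)

/-- A boxed observable with no flavours has a measurable Berezin scalar on every torus placement. -/
theorem measurable_fermiIntegral_onTorus {R : ℕ} (A : QCDLatticeObservable 0 R) (S : ℕ) [NeZero S]
    (v : Literature.Probability.LatticeModels.Site 4) :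
    Measurable fun U : GaugeConfig 4 S (Matrix.specialUnitaryGroup (Fin 3) ℂ) => fermiIntegral (A.onTorus S v U) := by
  have hm := A.measurable 1
  simp only [mul_one] at hm
  have hfun : (fun U : GaugeConfig 4 S (Matrix.specialUnitaryGroup (Fin 3) ℂ) => fermiIntegral (A.onTorus S v U)) =
      (fun W : LGConfig 4 (Matrix.specialUnitaryGroup (Fin 3) ℂ) => GrassmannAlgebra.berezin ℂ (BoxFermiIdx 0 R ⊕ₗ BoxFermiIdx 0 R) (A.F W)) ∘
        fun U : GaugeConfig 4 S (Matrix.specialUnitaryGroup (Fin 3) ℂ) =>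
          Literature.MathematicalPhysics.QuantumLattice.configShift (-v) (torusLift S U) := by
    funext U
    exact fermiIntegral_onTorus_zero_flavour A S v U
  rw [hfun]
  exact hm.comp ((Literature.MathematicalPhysics.QuantumLattice.configShift (-v)).measurable.comp
    (measurable_torusLift S))

/-- The torus links READ by a boxed observable placed at `v`: the images of its support links,
translated by `v`, under the periodic projection. -/
theorem dependsOn_fermiIntegral_onTorus {R : ℕ} (A : QCDLatticeObservable 0 R) (S : ℕ) [NeZero S]
    (v : Literature.Probability.LatticeModels.Site 4) :
    DependsOn (fun U : GaugeConfig 4 S (Matrix.specialUnitaryGroup (Fin 3) ℂ) => fermiIntegral (A.onTorus S v U))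
      ↑(A.supp.image fun e : Literature.MathematicalPhysics.QuantumLattice.ZdEdge 4 => torusEdge S (e.1 + v, e.2)) := by
  intro U U' hUU'
  simp only [fermiIntegral_onTorus_zero_flavour]
  congr 1
  apply A.isCylinder
  intro e he
  have h := hUU' _ (Finset.mem_coe.2 (Finset.mem_image_of_mem _ he))
  simpa [Literature.MathematicalPhysics.QuantumLattice.configShift_apply, torusLift, sub_neg_eq_add] using h

end ZeroFlavour

/-! ### `β = 0`: the product Haar measure and independence of disjoint link sets -/

section BetaZero

variable {d L N : ℕ} [NeZero L] {G : Type*} [Group G] [TopologicalSpace G] [IsTopologicalGroup G]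
  [CompactSpace G] [MeasurableSpace G] [BorelSpace G] (ρ : G →* Matrix (Fin N) (Fin N) ℂ)

/-- **At `β = 0` the Wilson measure is the product Haar measure** (density `e^0 = 1`, partition
function `1`). -/
theorem wilsonMeasure_beta_zero [IsProbabilityMeasure (haarProbability G)] :
    wilsonMeasure (d := d) (L := L) ρ 0 = Measure.pi fun _ : Edge d L => haarProbability G := by
  have hw : wilsonWeight (d := d) (L := L) ρ 0 = Measure.pi fun _ : Edge d L => haarProbability G := by
    have h1 : (fun U : GaugeConfig d L G => ENNReal.ofReal (Real.exp (-0 * wilsonAction ρ U))) = 1 := by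
      funext U
      simp
    unfold wilsonWeight
    rw [h1, withDensity_one]
  unfold wilsonMeasure partitionFunction
  rw [hw, measure_univ, inv_one, one_smul]

end BetaZero

section Independence

variable {ι : Type*} [Fintype ι] [DecidableEq ι] {Ω : Type*} [MeasurableSpace Ω]
  (μ : Measure Ω) [IsProbabilityMeasure μ]

/-- **Bounded measurable functions of disjoint coordinate blocks are uncorrelated under a finite
product of probability measures** (complex-valued): `∫ F·G = (∫ F)(∫ G)` if `F` depends only on
the coordinates in `S`, `G` only on those in `T`, `S ∩ T = ∅` (Mathlib `iIndepFun_pi`,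
`IndepFun.integral_mul_eq_mul_integral`). -/
theorem integral_mul_eq_of_dependsOn_disjoint_pi {S T : Finset ι} (hST : Disjoint S T)
    {F G : (ι → Ω) → ℂ} (hFm : Measurable F) (hGm : Measurable G)
    (hF : DependsOn F (↑S : Set ι)) (hG : DependsOn G (↑T : Set ι)) :
    ∫ x, F x * G x ∂(Measure.pi fun _ : ι => μ) =
      (∫ x, F x ∂(Measure.pi fun _ : ι => μ)) * ∫ x, G x ∂(Measure.pi fun _ : ι => μ) := by
  rcases isEmpty_or_nonempty (ι → Ω) with hE | ⟨⟨x₀⟩⟩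
  · simp [integral_of_isEmpty]
  set P : Measure (ι → Ω) := Measure.pi fun _ : ι => μ with hP
  -- independence of the coordinate blocks
  have hind : iIndepFun (fun (i : ι) (x : ι → Ω) => x i) P :=
    iIndepFun_pi (X := fun (_ : ι) (t : Ω) => t) fun _ => aemeasurable_id
  have hXY : IndepFun (fun (x : ι → Ω) (i : S) => x i) (fun (x : ι → Ω) (i : T) => x i) P :=
    hind.indepFun_finset S T hST fun i => measurable_pi_apply i
  -- factor `F`, `G` through the blocks
  set F' : (↥S → Ω) → ℂ := fun y => F (Function.updateFinset x₀ S y) with hF'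
  set G' : (↥T → Ω) → ℂ := fun y => G (Function.updateFinset x₀ T y) with hG'
  have eF : F = F' ∘ fun (x : ι → Ω) (i : S) => x i := by
    funext x
    refine hF fun i hi => ?_
    simp [Function.updateFinset, Finset.mem_coe.1 hi]
  have eG : G = G' ∘ fun (x : ι → Ω) (i : T) => x i := by
    funext x
    refine hG fun i hi => ?_
    simp [Function.updateFinset, Finset.mem_coe.1 hi]
  have hF'm : Measurable F' := hFm.comp measurable_updateFinset
  have hG'm : Measurable G' := hGm.comp measurable_updateFinset
  have hFG : IndepFun F G P := by
    rw [eF, eG]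
    exact hXY.comp hF'm hG'm
  have h := hFG.integral_mul_eq_mul_integral hFm.aestronglyMeasurable hGm.aestronglyMeasurable
  simpa using h

end Independence

end Summit.QuantumFields.QCD.Theorems.UniformGapTreeDecay.EmptyFlavour

end
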